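import Literature.MathematicalPhysics.QuantumFieldTheory.Balaban1983to89.B5Eq129FreeResolventSupBound
import Literature.MathematicalPhysics.QuantumFieldTheory.Balaban1983to89.B9Eq342SupNormBootstrap

/-!
# `Balaban1983to89.B5Eq129FreeResolventDecayedLetter` — T. Bałaban, *Propagators and renormalization transformations for lattice gauge theories. I*, Commun.
# Math. Phys. **95** (1984) 17–40 [Balaban1984PropagatorsI] (1.29)∕(1.31) p. 23, Prop. 1.1 p. 33, with *Propagators for lattice gauge theories in a background
# field*, Commun. Math. Phys. **99** (1985) 389–434 [Balaban1985BackgroundPropagators] (3.11) p. 392, (3.39) p. 397, Thm 3.1 (3.42) p. 397 (the factor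
# `e^{−δ₀d(y,y′)}`): **(D-FS) THE DECAYED FREE LETTER — the value of the `k`-fold free resolvent at ONE output site `x₀` against ANY SUPERSOLUTION WEIGHT `W`
# (`λW ≤ LW`, `0 < λ`): `φ_k(x₀) ≤ √(ḡ_k·λ^{−k}·W(x₀)∕c₀)·√(Σ_y c₀φ₀(y)²∕W(y))`, `ḡ_k = |T|⁻¹Σ_p(Δ_t(p)+m)^{−k}`** — storey (D) «decay in `d(y,y′)`» of the NE9
# owner's SUP-NORM PROGRAMME (plan v10, `g89/SUP-NORM-PROGRAMME.md` §5 (D-FS)); the weighted twin of this lineage's (FS-b) `B5Eq129FreeResolventZoneSum`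
# (the LEVEL-FREE value of `ḡ_k` for `k ≥ d` and the `cosh` instances are the companion files `B5Eq129FreeResolventZoneSumLetters` §5 ∕ `…DecayedLetterCosh`)

statement-level skeleton of published theorems with citation tags; proofs where landed; nothing here is a claim about the Yang–Mills mass gap

CITATION HEADER (lean-in-tree rule).  Audit cell `pub-balaban`, sub-cell `t4`, BINDER row NE9; filed by NE9 formalisation-swarm LEAF PROVER 02 (lineage
`b2b-balaban-t4-ne9-formalise-leaf-02`, gen 71) on the row OWNER `t4-ne9-p1` g89's plan v10 §5 STOREY (D), item (D-FS) *«THE DECAYED FREE LETTER with THREE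
resolvent powers (not two) … in d = 4 use R⁴ … C₃′² = Cλ^{−k}∕c₁»*, whose FIRST REFUSAL §5 names «(D-MP)∕(D-FS) ne9-leaf-02 (continuing (FS-b))»; journal
[NE9LEAF02-G71-OFFER-DFS].  MECHANISM ([folklore] lattice calculus): (a) the flat stencil `(Lφ)(x) = Σ_ν t²[(φ x − φ(x−e_ν)) + (φ x − φ(x+e_ν))] + mφ x` is
SYMMETRIC on the torus ⇒ CHAIN DUALITY `Σ_y G_k(y)ψ(y) = φ_k(x₀)` for the `δ_{x₀}`-chain `G`; (b) the WEIGHTED ROW SUM `Σ_y G_k(y)W(y) ≤ λ^{−k}W(x₀)` by duality with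
`W`'s chain and the comparison `B9Eq342SupNormBootstrap.scalar_le_mul_of_supersolution` iterated; (c) the ENTRY BOUND `0 ≤ G_k ≤ ḡ_k` by the positivity
`B9Eq323KatoDomination.scalar_nonneg_of_resolvent` and Fourier inversion (`B5Eq129FreeResolventSupBound.ft_resolvent`, King's `inversion`; `|δ̂_{x₀}(p)| = 1`); (d)
Cauchy–Schwarz `Σ_y G_kψ ≤ √(Σ G_k²W)·√(Σ ψ²∕W)`, `Σ G_k²W ≤ ḡ_k·Σ G_kW`.  The graph-form lemmas are used under the `Sum.elim` encoding `J = Fin d ⊕ Fin d`,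
`w ≡ t²` (the OWNER's `B5Eq129FreeResolventSupBoundSites` encoding, re-derived here because that file is not yet in the tree).  The weight technique is the
textbook Agmon∕Combes–Thomas supersolution method (METHOD only, as in the OWNER's `B9Eq342SupNormBootstrapWeighted`); the maximum principle is
[DodziukMathai2006] Lemma 1.1 as vendored BY NAME through `B9Eq323KatoDomination`.  Sources READ first-hand (this seat, `paper:balaban1985-cmp99-background-propagators`,
PDF = printed − 388): p. 397 (3.39), (3.41), Thm 3.1 (3.42) with «the weighted distance d(y,y′) defined by (2.36) in [4]», p. 392 (3.11).  NOTHING of print's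
random-walk proof (pp. 415–426) is reproduced; the `[cite: …]` tags are TEXT LOCATIONS of the printed symbols only; every statement is `[folklore]` (ABSOLUTE
RULE: nothing is minted as a cited fact).

WHAT IS PROVED (sorry-free; 0 `def`).
* §0 `step_nonneg`, `exists_chain` — positivity and solvability of the stencil step ∕ of a `k`-chain (graph lemmas under the encoding).
* §1 `stencil_symm` — `Σ_x (Lf)(x)g(x) = Σ_x f(x)(Lg)(x)`; `chain_duality` — for chains `Lφ_{j+1} = φ_j`, `LG_{j+1} = G_j` (`j < k`): `Σ_y G_k(y)φ₀(y) = Σ_y G₀(y)φ_k(y)`.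
* §2 `ft_chain`, **`abs_chain_le`** — `|φ_k(y)| ≤ ḡ_k·Σ_z|φ₀(z)|` (`ℓ¹ → ℓ^∞` for the `k`-fold free resolvent, Fourier).
* §3 **`weightChain_le`** — `W`'s chain obeys `Φ_j ≤ λ^{−j}W` (`λW ≤ LW`, `0 < λ`).
* §4 **`chain_apply_le_weighted`** — the displayed (D-FS) letter for ANY positive supersolution weight, any `k`, any real `t`, `0 < m`, `0 < c₀`.
HONEST SCOPE.  [folklore] finite-torus calculus; FREE flat Laplacian only (no background, no `Q′*Q′`, no window); `λ > 0` and `λW ≤ LW` are HYPOTHESES (inhabited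
by `B5Eq129CoshSupersolution.weight_supersolution` in the companion); nothing of [B9] Thm 3.1 ∕ [B5] Prop. 1.1 asserted or valued.  NOT summit progress (cell
pub-balaban: NE9 NOT PRINTED ∕ NOT PROVED; «NE9 ⇐ the named binders»; row WALLED ON A MODEL (O-NE9-1; #5 UNRULED); spine PROVED 0∕9; rung (B)+1 finite T⁴ — NOT
infinite volume, NOT mass gap, NOT BetaPertH, NOT Clay).  HONEST DEPENDENCY (cell line): continuum YM on T⁴ ⇐ BetaPertH ∧ nine spine estimates (0/9 proved);
BetaPertH ⇐ (D1) ∧ (D4) ∧ CAP+tail; G-an2-4 gates asym, D1 and NE2/3/4.  NEW file importing `B5Eq129FreeResolventSupBound` + `B9Eq342SupNormBootstrap` only;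
nothing modified.  Net new unproved facts: 0.
-/

noncomputable section

open scoped BigOperators ComplexConjugate

namespace Literature.MathematicalPhysics.QuantumFieldTheory.Balaban1983to89.B5Eq129FreeResolventDecayedLetter

open B5Prop11Plancherel (Tor chi unitVec)
open Literature.MathematicalPhysics.QuantumFieldTheory.King1986.Torus (ft inversion)
open B5Eq129FreeResolventSupBound (symbol_nonneg ft_resolvent norm_mul_chi)
open B9Eq323KatoDomination (exists_scalar_resolvent scalar_nonneg_of_resolvent)
open B9Eq342SupNormBootstrap (scalar_le_mul_of_supersolution)

variable {d : ℕ} (N : Fin d → ℕ) [hN : ∀ μ, NeZero (N μ)]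

/-! ## §0 The `Sum.elim` encoding of the flat stencil as a weighted graph (`J = Fin d ⊕ Fin d`, `w ≡ t²`) -/

section Encoding

omit hN in
/-- the graph sum of the encoding is the flat stencil. [folklore] -/
private theorem sumElim_stencil (t : ℝ) (φ : Tor N → ℝ) (x : Tor N) :
    ∑ j : Fin d ⊕ Fin d, t ^ 2 * (φ x - φ (Sum.elim (fun ν => x - unitVec N ν) (fun ν => x + unitVec N ν) j)) =
      ∑ ν, t ^ 2 * ((φ x - φ (x - unitVec N ν)) + (φ x - φ (x + unitVec N ν))) := by
  rw [Fintype.sum_sum_type, ← Finset.sum_add_distrib]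
  exact Finset.sum_congr rfl fun ν _ => by simp only [Sum.elim_inl, Sum.elim_inr]; ring

omit hN in
/-- a stencil equation in graph form. [folklore] -/
private theorem toSum (t : ℝ) {m : ℝ} {φ g : Tor N → ℝ}
    (hφ : ∀ x, ∑ ν, t ^ 2 * ((φ x - φ (x - unitVec N ν)) + (φ x - φ (x + unitVec N ν))) + m * φ x = g x) (x : Tor N) :
    ∑ j : Fin d ⊕ Fin d, t ^ 2 * (φ x - φ (Sum.elim (fun ν => x - unitVec N ν) (fun ν => x + unitVec N ν) j)) + m * φ x = g x := by
  rw [sumElim_stencil]; exact hφ x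

omit hN in
/-- a supersolution inequality in graph form. [folklore] -/
private theorem toSum_le (t : ℝ) {m lam : ℝ} {W : Tor N → ℝ}
    (hsup : ∀ x, lam * W x ≤ ∑ ν, t ^ 2 * ((W x - W (x - unitVec N ν)) + (W x - W (x + unitVec N ν))) + m * W x) (x : Tor N) :
    lam * W x ≤ ∑ j : Fin d ⊕ Fin d, t ^ 2 * (W x - W (Sum.elim (fun ν => x - unitVec N ν) (fun ν => x + unitVec N ν) j)) + m * W x := by
  rw [sumElim_stencil]; exact hsup x

/-- solvability of one stencil step `Lφ = g` (`0 < m`). [folklore] -/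
private theorem exists_step (t : ℝ) {m : ℝ} (hm : 0 < m) (g : Tor N → ℝ) :
    ∃ φ : Tor N → ℝ, ∀ x, ∑ ν, t ^ 2 * ((φ x - φ (x - unitVec N ν)) + (φ x - φ (x + unitVec N ν))) + m * φ x = g x := by
  obtain ⟨φ, hφ⟩ := exists_scalar_resolvent
    (fun (x : Tor N) (j : Fin d ⊕ Fin d) => Sum.elim (fun ν => x - unitVec N ν) (fun ν => x + unitVec N ν) j)
    (fun _ _ => t ^ 2) (fun _ _ => sq_nonneg t) hm g
  refine ⟨φ, fun x => ?_⟩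
  have h := hφ x
  simp only [sumElim_stencil] at h
  exact h

/-- **POSITIVITY OF ONE STENCIL STEP**: `Lφ = g ≥ 0 ⟹ φ ≥ 0` ([DodziukMathai2006] Lemma 1.1 under the `Sum.elim` encoding, BY NAME from
`B9Eq323KatoDomination.scalar_nonneg_of_resolvent`). [cite: DodziukMathai2006, Lemma 1.1 §1; Balaban1984PropagatorsI, (1.29) p.23] -/
theorem step_nonneg (t : ℝ) {m : ℝ} (hm : 0 < m) {φ g : Tor N → ℝ}
    (hφ : ∀ x, ∑ ν, t ^ 2 * ((φ x - φ (x - unitVec N ν)) + (φ x - φ (x + unitVec N ν))) + m * φ x = g x)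
    (hg : ∀ x, 0 ≤ g x) (x : Tor N) : 0 ≤ φ x :=
  scalar_nonneg_of_resolvent
    (fun (x : Tor N) (j : Fin d ⊕ Fin d) => Sum.elim (fun ν => x - unitVec N ν) (fun ν => x + unitVec N ν) j)
    (fun _ _ => t ^ 2) (fun _ _ => sq_nonneg t) hm (toSum N t hφ) hg x

/-- **SOLVABILITY OF A `k`-CHAIN**: from any datum `ψ` there is a chain `φ₀ = ψ`, `Lφ_{j+1} = φ_j` (`j < k`) ([DodziukMathai2006] Lemma 1.1's `(Δ+λI)⁻¹`
iterated, BY NAME from `B9Eq323KatoDomination.exists_scalar_resolvent`). [cite: DodziukMathai2006, Lemma 1.1 §1; Balaban1984PropagatorsI, (1.29) p.23] -/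
theorem exists_chain (t : ℝ) {m : ℝ} (hm : 0 < m) (ψ : Tor N → ℝ) (k : ℕ) :
    ∃ φ : ℕ → Tor N → ℝ, φ 0 = ψ ∧ ∀ j < k, ∀ x,
      ∑ ν, t ^ 2 * ((φ (j + 1) x - φ (j + 1) (x - unitVec N ν)) + (φ (j + 1) x - φ (j + 1) (x + unitVec N ν))) + m * φ (j + 1) x = φ j x := by
  induction k with
  | zero => exact ⟨fun _ => ψ, rfl, fun j hj => absurd hj (Nat.not_lt_zero j)⟩
  | succ k ih =>
      obtain ⟨φ, h0, hφ⟩ := ih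
      obtain ⟨χ, hχ⟩ := exists_step N t hm (φ k)
      refine ⟨fun j => if j = k + 1 then χ else φ j, ?_, fun j hj x => ?_⟩
      · show (if 0 = k + 1 then χ else φ 0) = ψ
        rw [if_neg (by omega), h0]
      · show ∑ ν, t ^ 2 * (((if j + 1 = k + 1 then χ else φ (j + 1)) x - (if j + 1 = k + 1 then χ else φ (j + 1)) (x - unitVec N ν)) +
            ((if j + 1 = k + 1 then χ else φ (j + 1)) x - (if j + 1 = k + 1 then χ else φ (j + 1)) (x + unitVec N ν))) +
            m * (if j + 1 = k + 1 then χ else φ (j + 1)) x = (if j = k + 1 then χ else φ j) x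
        rcases Nat.lt_or_ge j k with hlt | hge
        · rw [if_neg (show j + 1 ≠ k + 1 by omega), if_neg (show j ≠ k + 1 by omega)]
          exact hφ j hlt x
        · have heq : j = k := by omega
          rw [if_pos (show j + 1 = k + 1 by omega), if_neg (show j ≠ k + 1 by omega), heq]
          exact hχ x

end Encoding

/-! ## §1 The stencil is symmetric on the torus; chain duality -/

section Symmetry

/-- `Σ_x f(x−e)g(x) = Σ_x f(x)g(x+e)` (reindex by `x ↦ x + e`). [folklore] -/
private theorem sum_shift_sub (f g : Tor N → ℝ) (e : Tor N) : ∑ x, f (x - e) * g x = ∑ x, f x * g (x + e) :=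
  (Fintype.sum_equiv (Equiv.addRight e) (fun x => f x * g (x + e)) (fun x => f (x - e) * g x)
    (fun x => by simp only [Equiv.coe_addRight, add_sub_cancel_right])).symm

/-- `Σ_x f(x+e)g(x) = Σ_x f(x)g(x−e)` (reindex by `x ↦ x − e`). [folklore] -/
private theorem sum_shift_add (f g : Tor N → ℝ) (e : Tor N) : ∑ x, f (x + e) * g x = ∑ x, f x * g (x - e) :=
  (Fintype.sum_equiv (Equiv.subRight e) (fun x => f x * g (x - e)) (fun x => f (x + e) * g x)
    (fun x => by simp [sub_add_cancel])).symm

/-- one bond direction of the symmetry. [folklore] -/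
private theorem sum_bond_symm (t : ℝ) (f g : Tor N → ℝ) (e : Tor N) :
    ∑ x, t ^ 2 * ((f x - f (x - e)) + (f x - f (x + e))) * g x = ∑ x, f x * (t ^ 2 * ((g x - g (x - e)) + (g x - g (x + e)))) := by
  have h1 : ∑ x, f (x - e) * g x = ∑ x, f x * g (x + e) := sum_shift_sub N f g e
  have h2 : ∑ x, f (x + e) * g x = ∑ x, f x * g (x - e) := sum_shift_add N f g e
  have eL : ∀ x, t ^ 2 * ((f x - f (x - e)) + (f x - f (x + e))) * g x =
      t ^ 2 * (2 * (f x * g x)) - t ^ 2 * (f (x - e) * g x) - t ^ 2 * (f (x + e) * g x) := fun x => by ring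
  have eR : ∀ x, f x * (t ^ 2 * ((g x - g (x - e)) + (g x - g (x + e)))) =
      t ^ 2 * (2 * (f x * g x)) - t ^ 2 * (f x * g (x + e)) - t ^ 2 * (f x * g (x - e)) := fun x => by ring
  simp only [eL, eR, Finset.sum_sub_distrib, ← Finset.mul_sum, h1, h2]

/-- **THE FLAT STENCIL IS SYMMETRIC ON THE TORUS**: `Σ_x (Lf)(x)·g(x) = Σ_x f(x)·(Lg)(x)` for
`(Lφ)(x) = Σ_ν t²[(φ x − φ(x−e_ν)) + (φ x − φ(x+e_ν))] + m·φ x`. [cite: Balaban1984PropagatorsI, (1.29) p.23, (1.31) p.23] -/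
theorem stencil_symm (t m : ℝ) (f g : Tor N → ℝ) :
    ∑ x, (∑ ν, t ^ 2 * ((f x - f (x - unitVec N ν)) + (f x - f (x + unitVec N ν))) + m * f x) * g x =
      ∑ x, f x * (∑ ν, t ^ 2 * ((g x - g (x - unitVec N ν)) + (g x - g (x + unitVec N ν))) + m * g x) := by
  calc ∑ x, (∑ ν, t ^ 2 * ((f x - f (x - unitVec N ν)) + (f x - f (x + unitVec N ν))) + m * f x) * g x
      = ∑ x, ((∑ ν, t ^ 2 * ((f x - f (x - unitVec N ν)) + (f x - f (x + unitVec N ν))) * g x) + m * (f x * g x)) :=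
        Finset.sum_congr rfl fun x _ => by rw [add_mul, Finset.sum_mul, mul_assoc]
    _ = ∑ ν, ∑ x, t ^ 2 * ((f x - f (x - unitVec N ν)) + (f x - f (x + unitVec N ν))) * g x + m * ∑ x, f x * g x := by
        rw [Finset.sum_add_distrib, Finset.sum_comm, ← Finset.mul_sum]
    _ = ∑ ν, ∑ x, f x * (t ^ 2 * ((g x - g (x - unitVec N ν)) + (g x - g (x + unitVec N ν)))) + m * ∑ x, f x * g x := by
        congr 1
        exact Finset.sum_congr rfl fun ν _ => sum_bond_symm N t f g (unitVec N ν)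
    _ = ∑ x, f x * (∑ ν, t ^ 2 * ((g x - g (x - unitVec N ν)) + (g x - g (x + unitVec N ν))) + m * g x) := by
        rw [Finset.sum_comm, Finset.mul_sum, ← Finset.sum_add_distrib]
        exact Finset.sum_congr rfl fun x _ => by rw [mul_add, Finset.mul_sum]; ring

/-- **CHAIN DUALITY**: if `Lφ_{j+1} = φ_j` and `LG_{j+1} = G_j` for `j < k`, then `Σ_y G_k(y)φ₀(y) = Σ_y G₀(y)φ_k(y)` (the stencil moved across `k` times).
[cite: Balaban1984PropagatorsI, (1.29) p.23, (1.31) p.23] -/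
theorem chain_duality (t m : ℝ) : ∀ (k : ℕ) (φ G : ℕ → Tor N → ℝ),
    (∀ j < k, ∀ x, ∑ ν, t ^ 2 * ((φ (j + 1) x - φ (j + 1) (x - unitVec N ν)) + (φ (j + 1) x - φ (j + 1) (x + unitVec N ν))) +
      m * φ (j + 1) x = φ j x) →
    (∀ j < k, ∀ x, ∑ ν, t ^ 2 * ((G (j + 1) x - G (j + 1) (x - unitVec N ν)) + (G (j + 1) x - G (j + 1) (x + unitVec N ν))) +
      m * G (j + 1) x = G j x) →
    ∑ y, G k y * φ 0 y = ∑ y, G 0 y * φ k y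
  | 0, _, _, _, _ => rfl
  | k + 1, φ, G, hφ, hG => by
      have h1 : ∑ y, G (k + 1) y * φ 0 y = ∑ y, G k y * φ 1 y := by
        calc ∑ y, G (k + 1) y * φ 0 y
            = ∑ y, G (k + 1) y * (∑ ν, t ^ 2 * ((φ 1 y - φ 1 (y - unitVec N ν)) + (φ 1 y - φ 1 (y + unitVec N ν))) + m * φ 1 y) :=
              Finset.sum_congr rfl fun y _ => by rw [hφ 0 (Nat.succ_pos k)]
          _ = ∑ y, (∑ ν, t ^ 2 * ((G (k + 1) y - G (k + 1) (y - unitVec N ν)) + (G (k + 1) y - G (k + 1) (y + unitVec N ν))) +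
                m * G (k + 1) y) * φ 1 y := (stencil_symm N t m (G (k + 1)) (φ 1)).symm
          _ = ∑ y, G k y * φ 1 y := Finset.sum_congr rfl fun y _ => by rw [hG k (lt_add_one k)]
      rw [h1]
      exact chain_duality t m k (fun j => φ (j + 1)) G (fun j hj => hφ (j + 1) (by omega)) (fun j hj => hG j (by omega))

end Symmetry

/-! ## §2 The entry bound: `ℓ¹ → ℓ^∞` for the `k`-fold free resolvent (Fourier) -/

section Entry

/-- `‖ψ̂(p)‖ ≤ Σ_z |ψ(z)|` (`|χ_p(z)| = 1`). [folklore] -/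
private theorem norm_ft_le (ψ : Tor N → ℝ) (p : Tor N) : ‖ft N ψ p‖ ≤ ∑ z, |ψ z| := by
  unfold ft
  refine (norm_sum_le _ _).trans (le_of_eq (Finset.sum_congr rfl fun z _ => ?_))
  have h1 : ‖chi N p z‖ = 1 := by simpa using norm_mul_chi N 1 p z
  rw [norm_mul, Complex.norm_real, Real.norm_eq_abs, Complex.norm_conj, h1, mul_one]

/-- **THE CHAIN IN FOURIER SPACE**: `φ̂_k(p)·(Δ_t(p)+m)^k = φ̂₀(p)`. [cite: Balaban1984PropagatorsI, (1.31) p.23] -/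
theorem ft_chain (t : ℝ) {m : ℝ} {k : ℕ} {φ : ℕ → Tor N → ℝ}
    (hφ : ∀ j < k, ∀ x, ∑ ν, t ^ 2 * ((φ (j + 1) x - φ (j + 1) (x - unitVec N ν)) + (φ (j + 1) x - φ (j + 1) (x + unitVec N ν))) +
      m * φ (j + 1) x = φ j x) (p : Tor N) :
    ft N (φ k) p * (((∑ ν, t ^ 2 * (2 - 2 * (chi N p (unitVec N ν)).re)) + m : ℝ) : ℂ) ^ k = ft N (φ 0) p := by
  induction k with
  | zero => simp
  | succ k ih =>
      have h := ft_resolvent N t m (hφ k (lt_add_one k)) p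
      calc ft N (φ (k + 1)) p * (((∑ ν, t ^ 2 * (2 - 2 * (chi N p (unitVec N ν)).re)) + m : ℝ) : ℂ) ^ (k + 1)
          = ((((∑ ν, t ^ 2 * (2 - 2 * (chi N p (unitVec N ν)).re)) + m : ℝ) : ℂ) * ft N (φ (k + 1)) p) *
              (((∑ ν, t ^ 2 * (2 - 2 * (chi N p (unitVec N ν)).re)) + m : ℝ) : ℂ) ^ k := by ring
        _ = ft N (φ k) p * (((∑ ν, t ^ 2 * (2 - 2 * (chi N p (unitVec N ν)).re)) + m : ℝ) : ℂ) ^ k := by rw [h]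
        _ = ft N (φ 0) p := ih fun j hj => hφ j (by omega)

/-- **THE ENTRY BOUND OF THE `k`-FOLD FREE RESOLVENT** (`ℓ¹ → ℓ^∞`): `|φ_k(y)| ≤ ḡ_k·Σ_z|φ₀(z)|` with `ḡ_k = |T|⁻¹·Σ_p (Δ_t(p)+m)^{−k}` — Fourier inversion,
`φ̂_k = φ̂₀∕(Δ_t+m)^k`, `|φ̂₀(p)| ≤ ‖φ₀‖_{ℓ¹}`.  With `φ₀ = δ_{x₀}`: every entry of the kernel is at most its diagonal Plancherel value `ḡ_k`.
[cite: Balaban1984PropagatorsI, (1.29) p.23, (1.31) p.23, Prop. 1.1 p.33] -/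
theorem abs_chain_le (t : ℝ) {m : ℝ} (hm : 0 < m) {k : ℕ} {φ : ℕ → Tor N → ℝ}
    (hφ : ∀ j < k, ∀ x, ∑ ν, t ^ 2 * ((φ (j + 1) x - φ (j + 1) (x - unitVec N ν)) + (φ (j + 1) x - φ (j + 1) (x + unitVec N ν))) +
      m * φ (j + 1) x = φ j x) (y : Tor N) :
    |φ k y| ≤ (∑ p : Tor N, (((∑ ν, t ^ 2 * (2 - 2 * (chi N p (unitVec N ν)).re)) + m) ^ k)⁻¹) / Fintype.card (Tor N) * ∑ z, |φ 0 z| := by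
  classical
  set σ : Tor N → ℝ := fun p => (∑ ν, t ^ 2 * (2 - 2 * (chi N p (unitVec N ν)).re)) + m with hσ
  have hσpos : ∀ p, 0 < σ p := fun p => add_pos_of_nonneg_of_pos (symbol_nonneg N t p) hm
  have hF : ∀ p, ft N (φ k) p = ft N (φ 0) p / (σ p : ℂ) ^ k := fun p => by
    have h := ft_chain N t hφ p
    rw [eq_div_iff (pow_ne_zero k (by exact_mod_cast (hσpos p).ne'))]
    exact h
  have hcard : (0 : ℝ) < Fintype.card (Tor N) := by exact_mod_cast Fintype.card_pos
  have hinv := inversion N (φ k) y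
  have hbound : (Fintype.card (Tor N) : ℝ) * |φ k y| ≤ ∑ p : Tor N, (σ p ^ k)⁻¹ * ∑ z, |φ 0 z| := by
    have h1 : (Fintype.card (Tor N) : ℝ) * |φ k y| = ‖∑ p : Tor N, ft N (φ k) p * chi N p y‖ := by
      rw [hinv, norm_mul, Complex.norm_natCast, Complex.norm_real, Real.norm_eq_abs]
    rw [h1]
    refine (norm_sum_le _ _).trans (Finset.sum_le_sum fun p _ => ?_)
    rw [norm_mul_chi, hF p, norm_div, norm_pow, Complex.norm_real, Real.norm_eq_abs, abs_of_pos (hσpos p), div_eq_inv_mul]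
    exact mul_le_mul_of_nonneg_left (norm_ft_le N (φ 0) p) (inv_nonneg.2 (pow_nonneg (hσpos p).le k))
  rw [div_mul_eq_mul_div, le_div_iff₀ hcard]
  calc |φ k y| * Fintype.card (Tor N) = (Fintype.card (Tor N) : ℝ) * |φ k y| := mul_comm _ _
    _ ≤ (∑ p : Tor N, (σ p ^ k)⁻¹) * ∑ z, |φ 0 z| := by rw [Finset.sum_mul]; exact hbound

end Entry

/-! ## §3 The weight's chain: `Φ_j ≤ λ^{−j}·W` for a supersolution weight -/

section Weight

/-- **ITERATED COMPARISON WITH A SUPERSOLUTION**: `λW ≤ LW` pointwise (`0 < λ`, `0 < m`), `Φ₀ = W`, `LΦ_{j+1} = Φ_j` (`j < k`) ⟹ `Φ_j ≤ λ^{−j}·W` for `j ≤ k`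
(`B9Eq342SupNormBootstrap.scalar_le_mul_of_supersolution` with `s = λ^{−(j+1)}`, induction). [cite: DodziukMathai2006, Lemma 1.1 §1; Balaban1985BackgroundPropagators, Thm 3.1 (3.42) p.397] -/
theorem weightChain_le (t : ℝ) {m lam : ℝ} (hm : 0 < m) (hlam : 0 < lam) {W : Tor N → ℝ}
    (hsup : ∀ x, lam * W x ≤ ∑ ν, t ^ 2 * ((W x - W (x - unitVec N ν)) + (W x - W (x + unitVec N ν))) + m * W x)
    {k : ℕ} {Φ : ℕ → Tor N → ℝ} (hΦ0 : Φ 0 = W)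
    (hΦ : ∀ j < k, ∀ x, ∑ ν, t ^ 2 * ((Φ (j + 1) x - Φ (j + 1) (x - unitVec N ν)) + (Φ (j + 1) x - Φ (j + 1) (x + unitVec N ν))) +
      m * Φ (j + 1) x = Φ j x) :
    ∀ j ≤ k, ∀ x, Φ j x ≤ (lam ^ j)⁻¹ * W x := by
  intro j hj
  induction j with
  | zero => intro x; rw [hΦ0, pow_zero, inv_one, one_mul]
  | succ j ih =>
      intro x
      have hprev := ih (Nat.le_of_succ_le hj)
      refine scalar_le_mul_of_supersolution
        (fun (x : Tor N) (i : Fin d ⊕ Fin d) => Sum.elim (fun ν => x - unitVec N ν) (fun ν => x + unitVec N ν) i)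
        (fun _ _ => t ^ 2) (fun _ _ => sq_nonneg t) hm (s := (lam ^ (j + 1))⁻¹) (by positivity)
        (toSum_le N t hsup) (toSum N t (hΦ j hj)) (fun y => ?_) x
      calc Φ j y ≤ (lam ^ j)⁻¹ * W y := hprev y
        _ = (lam ^ (j + 1))⁻¹ * (lam * W y) := by rw [pow_succ]; field_simp

end Weight

/-! ## §4 (D-FS) THE DECAYED FREE LETTER for any positive supersolution weight -/

section Letter

/-- **(D-FS) THE DECAYED FREE LETTER.**  On the torus `Π_ν ℤ∕N_ν` with the flat stencil `L` (difference quotient `t`, mass `0 < m`), a weight `0 < c₀`, a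
`k`-chain `Lφ_{j+1} = φ_j` (`j < k`) and ANY supersolution weight `W > 0`, `λ·W ≤ LW` pointwise (`0 < λ`):
`φ_k(x₀) ≤ √(ḡ_k·λ^{−k}·W(x₀)∕c₀) · √(Σ_y c₀·φ₀(y)²∕W(y))`, `ḡ_k = |T|⁻¹·Σ_p (Δ_t(p)+m)^{−k}` — the letter that bounds the free scalar value `χ(x₀)` of
`B9Eq342SupNormBootstrapWeighted` by a `W`-weighted, hence DECAYING, size of the source: duality with the `δ_{x₀}`-chain, weighted row sum `≤ λ^{−k}W(x₀)`,
entry bound `≤ ḡ_k`, Cauchy–Schwarz. [cite: Balaban1985BackgroundPropagators, Thm 3.1 (3.42) p.397, (3.39) p.397, (3.11) p.392; Balaban1984PropagatorsI, (1.29) p.23, Prop. 1.1 p.33] -/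
theorem chain_apply_le_weighted (t : ℝ) {m c₀ lam : ℝ} (hm : 0 < m) (hc₀ : 0 < c₀) (hlam : 0 < lam)
    {W : Tor N → ℝ} (hW : ∀ y, 0 < W y)
    (hsup : ∀ y, lam * W y ≤ ∑ ν, t ^ 2 * ((W y - W (y - unitVec N ν)) + (W y - W (y + unitVec N ν))) + m * W y)
    {k : ℕ} {φ : ℕ → Tor N → ℝ}
    (hφ : ∀ j < k, ∀ x, ∑ ν, t ^ 2 * ((φ (j + 1) x - φ (j + 1) (x - unitVec N ν)) + (φ (j + 1) x - φ (j + 1) (x + unitVec N ν))) +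
      m * φ (j + 1) x = φ j x) (x₀ : Tor N) :
    φ k x₀ ≤ Real.sqrt ((∑ p : Tor N, (((∑ ν, t ^ 2 * (2 - 2 * (chi N p (unitVec N ν)).re)) + m) ^ k)⁻¹) / Fintype.card (Tor N) *
        (lam ^ k)⁻¹ * W x₀ / c₀) * Real.sqrt (∑ y, c₀ * φ 0 y ^ 2 / W y) := by
  classical
  set gbar := (∑ p : Tor N, (((∑ ν, t ^ 2 * (2 - 2 * (chi N p (unitVec N ν)).re)) + m) ^ k)⁻¹) / Fintype.card (Tor N) with hgbar
  have hgbar0 : 0 ≤ gbar :=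
    div_nonneg (Finset.sum_nonneg fun p _ => inv_nonneg.2 (pow_nonneg (add_pos_of_nonneg_of_pos (symbol_nonneg N t p) hm).le _))
      (Nat.cast_nonneg _)
  -- the `δ_{x₀}`-chain and the `W`-chain
  obtain ⟨G, hG0, hG⟩ := exists_chain N t hm (fun y => if y = x₀ then (1 : ℝ) else 0) k
  obtain ⟨Φ, hΦ0, hΦ⟩ := exists_chain N t hm W k
  -- positivity of the `δ_{x₀}`-chain
  have hGnn : ∀ j ≤ k, ∀ y, 0 ≤ G j y := by
    intro j hj
    induction j with
    | zero =>
        intro y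
        rw [hG0]
        show (0 : ℝ) ≤ if y = x₀ then 1 else 0
        split_ifs <;> norm_num
    | succ j ih => exact step_nonneg N t hm (hG j hj) (ih (Nat.le_of_succ_le hj))
  -- the entry bound of the `δ_{x₀}`-chain
  have hG0sum : ∑ z, |G 0 z| = 1 := by
    have habs : ∑ z, |G 0 z| = ∑ z, G 0 z := Finset.sum_congr rfl fun z _ => abs_of_nonneg (hGnn 0 (Nat.zero_le k) z)
    rw [habs, hG0]
    simp only [Finset.sum_ite_eq', Finset.mem_univ, if_true]
  have hGle : ∀ y, G k y ≤ gbar := fun y => by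
    have h := abs_chain_le N t hm hG y
    rw [hG0sum, mul_one] at h
    exact (le_abs_self _).trans h
  -- duality 1: the value at `x₀`
  have hd1 : ∑ y, G k y * φ 0 y = φ k x₀ := by
    rw [chain_duality N t m k φ G hφ hG, hG0]
    simp only [ite_mul, one_mul, zero_mul, Finset.sum_ite_eq', Finset.mem_univ, if_true]
  -- duality 2 + comparison: the weighted row sum
  have hd2 : ∑ y, G k y * W y ≤ (lam ^ k)⁻¹ * W x₀ := by
    have e : ∑ y, G k y * W y = Φ k x₀ := by
      rw [show W = Φ 0 from hΦ0.symm, chain_duality N t m k Φ G hΦ hG, hG0]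
      simp only [ite_mul, one_mul, zero_mul, Finset.sum_ite_eq', Finset.mem_univ, if_true]
    rw [e]
    have h := weightChain_le N t hm hlam hsup hΦ0 hΦ k le_rfl x₀
    exact h
  -- Cauchy–Schwarz with the weight split `G_k√W · ψ∕√W`
  have hsW : ∀ y, Real.sqrt (W y) ≠ 0 := fun y => (Real.sqrt_pos.2 (hW y)).ne'
  have hCS := Finset.sum_mul_sq_le_sq_mul_sq Finset.univ (fun y => G k y * Real.sqrt (W y)) (fun y => φ 0 y * (Real.sqrt (W y))⁻¹)
  have hab : ∀ y, G k y * Real.sqrt (W y) * (φ 0 y * (Real.sqrt (W y))⁻¹) = G k y * φ 0 y := fun y => by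
    rw [mul_mul_mul_comm, mul_inv_cancel₀ (hsW y), mul_one]
  have ha2 : ∀ y, (G k y * Real.sqrt (W y)) ^ 2 = G k y ^ 2 * W y := fun y => by rw [mul_pow, Real.sq_sqrt (hW y).le]
  have hb2 : ∀ y, (φ 0 y * (Real.sqrt (W y))⁻¹) ^ 2 = φ 0 y ^ 2 / W y := fun y => by
    rw [mul_pow, inv_pow, Real.sq_sqrt (hW y).le, div_eq_mul_inv]
  simp only [hab, ha2, hb2, hd1] at hCS
  have hA : ∑ y, G k y ^ 2 * W y ≤ gbar * ((lam ^ k)⁻¹ * W x₀) := by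
    calc ∑ y, G k y ^ 2 * W y ≤ ∑ y, gbar * (G k y * W y) := Finset.sum_le_sum fun y _ => by
            rw [sq, mul_assoc]
            exact mul_le_mul_of_nonneg_right (hGle y) (mul_nonneg (hGnn k le_rfl y) (hW y).le)
      _ = gbar * ∑ y, G k y * W y := by rw [Finset.mul_sum]
      _ ≤ gbar * ((lam ^ k)⁻¹ * W x₀) := mul_le_mul_of_nonneg_left hd2 hgbar0
  have hB0 : 0 ≤ ∑ y, φ 0 y ^ 2 / W y := Finset.sum_nonneg fun y _ => div_nonneg (sq_nonneg _) (hW y).le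
  have hsum : ∑ y, c₀ * φ 0 y ^ 2 / W y = c₀ * ∑ y, φ 0 y ^ 2 / W y := by
    rw [Finset.mul_sum]
    exact Finset.sum_congr rfl fun y _ => by ring
  have hsq : φ k x₀ ^ 2 ≤ (gbar * (lam ^ k)⁻¹ * W x₀ / c₀) * (∑ y, c₀ * φ 0 y ^ 2 / W y) := by
    calc φ k x₀ ^ 2 ≤ (∑ y, G k y ^ 2 * W y) * ∑ y, φ 0 y ^ 2 / W y := hCS
      _ ≤ (gbar * ((lam ^ k)⁻¹ * W x₀)) * ∑ y, φ 0 y ^ 2 / W y := mul_le_mul_of_nonneg_right hA hB0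
      _ = (gbar * (lam ^ k)⁻¹ * W x₀ / c₀) * (∑ y, c₀ * φ 0 y ^ 2 / W y) := by
          rw [hsum]; field_simp
  have hX : 0 ≤ gbar * (lam ^ k)⁻¹ * W x₀ / c₀ :=
    div_nonneg (mul_nonneg (mul_nonneg hgbar0 (inv_nonneg.2 (pow_nonneg hlam.le k))) (hW x₀).le) hc₀.le
  calc φ k x₀ ≤ |φ k x₀| := le_abs_self _
    _ = Real.sqrt (φ k x₀ ^ 2) := (Real.sqrt_sq_eq_abs _).symm
    _ ≤ Real.sqrt ((gbar * (lam ^ k)⁻¹ * W x₀ / c₀) * (∑ y, c₀ * φ 0 y ^ 2 / W y)) := Real.sqrt_le_sqrt hsq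
    _ = Real.sqrt (gbar * (lam ^ k)⁻¹ * W x₀ / c₀) * Real.sqrt (∑ y, c₀ * φ 0 y ^ 2 / W y) := Real.sqrt_mul hX _

end Letter

end Literature.MathematicalPhysics.QuantumFieldTheory.Balaban1983to89.B5Eq129FreeResolventDecayedLetter

end
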